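import Mathlib.Data.Set.Card
import Mathlib.Data.Fintype.Pi
import Mathlib.Analysis.SpecialFunctions.Pow.Real
import Mathlib.Order.Interval.Finset.Nat
import HarnessLib

/-!
# Conformal removability: counting the leaves of a tree with many good nodes (mean porosity)

Support for the proof of `JonesSmirnov2000_frontier_of_isHolderDomain` (Jones–Smirnov 2000,
Cor. 2; `ConformalRemovability.lean`). The summability hypothesis `Σ_Q q(Q)² l(Q)² < ∞` of
Jones–Smirnov's Theorem 2 holds for Hölder domains because their boundaries have Minkowski
dimension `< 2`; following P. Koskela and S. Rohde, *Hausdorff dimension and mean porosity*,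
Math. Ann. 309 (1997) 593–609, this comes from MEAN POROSITY of the boundary: at every boundary
point, at a fixed proportion of all dyadic scales, a ball of comparable size next to the point
misses the boundary. The dimension estimate for mean porous sets is a counting statement about the
tree of dyadic squares meeting the set, which we isolate here in abstract form:

* nodes `N` with a parent map `par : N → N` whose fibres are coded injectively by `Fin 4`
  (`code`, think of the four quadrants), so that a node has at most `4^k` descendants `k` levels
  down (`card_le_pow_of_iterate_eq`);
* a set `O` of OCCUPIED nodes closed under `par` (the squares meeting the set) and a set `Gd` of
  GOOD nodes each of which has an unoccupied descendant `m` levels down (a hole);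
* `card_le_of_good_ancestors` — **the tree count**: if every node of a finite family `S ⊆ O` of
  descendants `L` levels below `R` has at least `G` good nodes among its ancestors up to `R`, then
  `|S| ≤ 4^L (1 - 4^{-m})^{⌊G/m⌋}` (induction on `L`: below a good root jump `m` levels — at most
  `4^m - 1` occupied nodes there, and at most `m` good ancestors are skipped; below any other root
  descend one level — at most `4` children, no good ancestor lost).

With `G ≥ c·L` good ancestors (mean porosity) this is `|S| ≤ 4^{(1-β)L}`-type growth, `β > 0`,
i.e. box-counting dimension `< 2`.

## References

* P. Koskela, S. Rohde, *Hausdorff dimension and mean porosity*, Math. Ann. 309 (1997) 593–609,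
  Thm. 2.1 (dimension of mean porous sets); the counting argument here is [folklore].
* [JonesSmirnov2000] P. W. Jones, S. K. Smirnov, Ark. Mat. 38 (2000) 263–279, Cor. 2 and §3.
-/

noncomputable section

open Set Function

namespace Literature.Probability.RandomPlanarGeometry

section TreeCount

variable {N : Type*} {par : N → N} {code : N → Fin 4}

/-- Nodes with the same parent and the same code coincide, iterated: two descendants `k` levels
below the same node with the same codes along the way coincide. [folklore] -/
theorem eq_of_iterate_eq_of_code_eq (hcode : ∀ D D', par D = par D' → code D = code D' → D = D')
    {k : ℕ} {D D' : N} (h : par^[k] D = par^[k] D')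
    (hc : ∀ i < k, code (par^[i] D) = code (par^[i] D')) : D = D' := by
  induction k generalizing D D' with
  | zero => simpa using h
  | succ k ih =>
    have h1 : par^[k] (par D) = par^[k] (par D') := by
      simpa only [Function.iterate_succ_apply] using h
    have h2 : ∀ i < k, code (par^[i] (par D)) = code (par^[i] (par D')) := fun i hi => by
      simpa only [Function.iterate_succ_apply] using hc (i + 1) (by omega)
    have hpar : par D = par D' := ih h1 h2
    exact hcode D D' hpar (by simpa using hc 0 (by omega))

/-- **At most `4^k` descendants `k` levels down**: a finite family of nodes `D` with
`par^[k] D = R` has at most `4^k` members (inject into the codes along the path). [folklore] -/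
theorem card_le_pow_of_iterate_eq (hcode : ∀ D D', par D = par D' → code D = code D' → D = D')
    {k : ℕ} {R : N} (S : Finset N) (hS : ∀ D ∈ S, par^[k] D = R) : S.card ≤ 4 ^ k := by
  classical
  have hinj : Set.InjOn (fun D : N => fun i : Fin k => code (par^[i.val] D)) ↑S := by
    intro D hD D' hD' h
    refine eq_of_iterate_eq_of_code_eq hcode ((hS D hD).trans (hS D' hD').symm) fun i hi => ?_
    exact congrFun h ⟨i, hi⟩
  calc S.card ≤ (Finset.univ : Finset (Fin k → Fin 4)).card :=
        Finset.card_le_card_of_injOn _ (fun _ _ => Finset.mem_univ _) hinj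
    _ = 4 ^ k := by simp [Finset.card_univ, Fintype.card_fin]

/-- Occupied sets closed under `par` are closed under its iterates. [folklore] -/
theorem iterate_mem_of_mem {O : Set N} (hO : ∀ D ∈ O, par D ∈ O) {D : N} (hD : D ∈ O) (k : ℕ) :
    par^[k] D ∈ O := by
  induction k with
  | zero => simpa using hD
  | succ k ih => rw [Function.iterate_succ_apply']; exact hO _ ih

/-- **The tree count** (the combinatorial core of the dimension estimate for mean porous sets,
Koskela–Rohde 1997, Thm. 2.1). Let the fibres of `par` be coded injectively by `Fin 4`, let `O`
(occupied nodes) be closed under `par`, and let every good node `P ∈ Gd` have an unoccupied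
descendant `m` levels down (`m ≥ 1`). If `S ⊆ O` is a finite family of nodes `L` levels below
`R` (`par^[L] D = R`) each of which has at least `G` good nodes among `par D, par^[2] D, …,
par^[L] D = R`, then `|S| ≤ 4^L (1 - 4^{-m})^{⌊G/m⌋}`. [folklore] -/
theorem card_le_of_good_ancestors (hcode : ∀ D D', par D = par D' → code D = code D' → D = D')
    {O Gd : Set N} (hO : ∀ D ∈ O, par D ∈ O) {m : ℕ} (hm : 0 < m)
    (hgood : ∀ P ∈ Gd, ∃ H, par^[m] H = P ∧ H ∉ O) :
    ∀ (L G : ℕ) (R : N) (S : Finset N), (∀ D ∈ S, D ∈ O) → (∀ D ∈ S, par^[L] D = R) →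
      (∀ D ∈ S, G ≤ {i : ℕ | i ∈ Set.Icc 1 L ∧ par^[i] D ∈ Gd}.ncard) →
      (S.card : ℝ) ≤ 4 ^ L * (1 - 1 / 4 ^ m) ^ (G / m) := by
  classical
  set ε : ℝ := 1 / 4 ^ m with hε
  have hε0 : 0 ≤ 1 - ε := by
    rw [hε, sub_nonneg, div_le_one (by positivity)]
    exact one_le_pow₀ (by norm_num)
  have hε1 : 1 - ε ≤ 1 := by rw [hε]; linarith [show (0 : ℝ) < 1 / 4 ^ m by positivity]
  intro L
  induction L using Nat.strong_induction_on with
  | _ L ih =>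
    intro G R S hSO hSR hSG
    -- the empty family
    rcases S.eq_empty_or_nonempty with hS | ⟨D₀, hD₀⟩
    · simp [hS]; positivity
    -- Case A: good root and `m ≤ L`: jump `m` levels
    by_cases hA : R ∈ Gd ∧ m ≤ L
    · obtain ⟨hR, hmL⟩ := hA
      obtain ⟨H, hH, hHO⟩ := hgood R hR
      -- the occupied nodes `m` levels below `R` through which `S` passes
      set T : Finset N := S.image fun D => par^[L - m] D with hT
      have hTsub : ∀ P ∈ T, par^[m] P = R ∧ P ∈ O := by
        intro P hP
        obtain ⟨D, hD, rfl⟩ := Finset.mem_image.1 hP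
        refine ⟨?_, iterate_mem_of_mem hO (hSO D hD) _⟩
        rw [← Function.iterate_add_apply, Nat.add_sub_cancel' hmL]
        exact hSR D hD
      have hTcard : (T.card : ℝ) ≤ 4 ^ m - 1 := by
        have hHT : H ∉ T := fun h => hHO (hTsub H h).2
        have h1 : (insert H T).card ≤ 4 ^ m :=
          card_le_pow_of_iterate_eq hcode _ fun P hP => by
            rcases Finset.mem_insert.1 hP with rfl | hP
            · exact hH
            · exact (hTsub P hP).1
        rw [Finset.card_insert_of_notMem hHT] at h1
        have : (T.card : ℝ) + 1 ≤ 4 ^ m := by exact_mod_cast h1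
        linarith
      -- decompose `S` along `T` and apply the induction hypothesis below each `P ∈ T`
      have hfib : ∀ P ∈ T, ((S.filter fun D => par^[L - m] D = P).card : ℝ) ≤
          4 ^ (L - m) * (1 - ε) ^ ((G - m) / m) := by
        intro P hP
        refine ih (L - m) (Nat.sub_lt (by omega) hm) (G - m) P _ (fun D hD => hSO D (Finset.mem_filter.1 hD).1)
          (fun D hD => (Finset.mem_filter.1 hD).2) fun D hD => ?_
        have hD := (Finset.mem_filter.1 hD).1
        -- at most `m` good ancestors are lost in the window `(L - m, L]`
        have hsplit : {i : ℕ | i ∈ Set.Icc 1 L ∧ par^[i] D ∈ Gd} ⊆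
            {i : ℕ | i ∈ Set.Icc 1 (L - m) ∧ par^[i] D ∈ Gd} ∪ Set.Icc (L - m + 1) L := by
          rintro i ⟨⟨hi1, hiL⟩, hiG⟩
          by_cases hi : i ≤ L - m
          · exact Or.inl ⟨⟨hi1, hi⟩, hiG⟩
          · exact Or.inr ⟨by omega, hiL⟩
        have hfinU : ({i : ℕ | i ∈ Set.Icc 1 (L - m) ∧ par^[i] D ∈ Gd} ∪
            Set.Icc (L - m + 1) L).Finite :=
          (Set.finite_Icc 1 L).subset (by
            rintro i (⟨⟨h1, h2⟩, _⟩ | ⟨h1, h2⟩) <;> exact ⟨by omega, by omega⟩)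
        have h1 : {i : ℕ | i ∈ Set.Icc 1 L ∧ par^[i] D ∈ Gd}.ncard ≤
            {i : ℕ | i ∈ Set.Icc 1 (L - m) ∧ par^[i] D ∈ Gd}.ncard + (Set.Icc (L - m + 1) L).ncard :=
          (Set.ncard_le_ncard hsplit hfinU).trans (Set.ncard_union_le _ _)
        have h2 : (Set.Icc (L - m + 1) L).ncard = m := by
          rw [Set.ncard_eq_toFinset_card', Set.toFinset_Icc, Nat.card_Icc]
          omega
        have := hSG D hD
        omega
      calc (S.card : ℝ) = ∑ P ∈ T, ((S.filter fun D => par^[L - m] D = P).card : ℝ) := by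
            rw [Finset.card_eq_sum_card_fiberwise (f := fun D => par^[L - m] D) (t := T)
              fun D hD => Finset.mem_image_of_mem _ hD]
            push_cast
            rfl
        _ ≤ ∑ P ∈ T, (4 : ℝ) ^ (L - m) * (1 - ε) ^ ((G - m) / m) := Finset.sum_le_sum hfib
        _ = T.card * ((4 : ℝ) ^ (L - m) * (1 - ε) ^ ((G - m) / m)) := by
            rw [Finset.sum_const, nsmul_eq_mul]
        _ ≤ (4 ^ m - 1) * ((4 : ℝ) ^ (L - m) * (1 - ε) ^ ((G - m) / m)) := by
            gcongr
        _ = 4 ^ L * ((1 - ε) * (1 - ε) ^ ((G - m) / m)) := by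
            have h4 : (4 : ℝ) ^ L = 4 ^ m * 4 ^ (L - m) := by
              rw [← pow_add, Nat.add_sub_cancel' hmL]
            have h5 : (4 : ℝ) ^ m - 1 = 4 ^ m * (1 - ε) := by
              rw [hε, mul_sub, mul_one, mul_one_div_cancel (pow_ne_zero _ (by norm_num))]
            rw [h5, h4]
            ring
        _ ≤ 4 ^ L * (1 - ε) ^ (G / m) := by
            gcongr
            rw [← pow_succ']
            refine pow_le_pow_of_le_one hε0 hε1 ?_
            -- `G / m ≤ (G - m) / m + 1`
            calc G / m ≤ (G - m + m) / m := Nat.div_le_div_right (by omega)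
              _ = (G - m) / m + 1 := Nat.add_div_right _ hm
    -- Case B: no jump
    · -- if the root is good then `L < m`, so `G < m` and the trivial bound suffices
      by_cases hR : R ∈ Gd
      · have hLm : L < m := by
          by_contra h
          exact hA ⟨hR, not_lt.1 h⟩
        have hG : G / m = 0 := by
          refine Nat.div_eq_of_lt ?_
          have h1 := hSG D₀ hD₀
          have h2 : {i : ℕ | i ∈ Set.Icc 1 L ∧ par^[i] D₀ ∈ Gd}.ncard ≤ (Set.Icc 1 L).ncard :=
            Set.ncard_le_ncard (fun i hi => hi.1) (Set.finite_Icc _ _)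
          have h3 : (Set.Icc 1 L).ncard = L := by
            rw [Set.ncard_eq_toFinset_card', Set.toFinset_Icc, Nat.card_Icc]
            omega
          omega
        rw [hG, pow_zero, mul_one]
        exact_mod_cast card_le_pow_of_iterate_eq hcode S hSR
      -- the root is not good: descend one level
      cases L with
      | zero =>
        -- `S ⊆ {R}`
        have hS1 : S.card ≤ 1 := by
          have := card_le_pow_of_iterate_eq hcode (k := 0) (R := R) S hSR
          simpa using this
        have hG : G / m = 0 := by
          refine Nat.div_eq_of_lt ?_
          have h1 := hSG D₀ hD₀
          have h2 : {i : ℕ | i ∈ Set.Icc 1 0 ∧ par^[i] D₀ ∈ Gd}.ncard = 0 := by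
            rw [Set.ncard_eq_zero]
            ext i
            simp only [Set.mem_setOf_eq, Set.mem_Icc, Set.mem_empty_iff_false, iff_false]
            omega
          omega
        rw [hG, pow_zero, pow_zero, mul_one]
        exact_mod_cast hS1
      | succ L =>
        -- the children of `R` through which `S` passes
        set C : Finset N := S.image fun D => par^[L] D with hC
        have hCsub : ∀ P ∈ C, par^[1] P = R := by
          intro P hP
          obtain ⟨D, hD, rfl⟩ := Finset.mem_image.1 hP
          rw [← Function.iterate_add_apply, Nat.add_comm]
          exact hSR D hD
        have hCcard : (C.card : ℝ) ≤ 4 := by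
          have := card_le_pow_of_iterate_eq hcode C hCsub
          exact_mod_cast this
        have hfib : ∀ P ∈ C, ((S.filter fun D => par^[L] D = P).card : ℝ) ≤
            4 ^ L * (1 - ε) ^ (G / m) := by
          intro P hP
          refine ih L (Nat.lt_succ_self L) G P _ (fun D hD => hSO D (Finset.mem_filter.1 hD).1)
            (fun D hD => (Finset.mem_filter.1 hD).2) fun D hD => ?_
          have hD := (Finset.mem_filter.1 hD).1
          -- the ancestor `par^[L+1] D = R` is not good, so nothing is lost
          have hsub : {i : ℕ | i ∈ Set.Icc 1 (L + 1) ∧ par^[i] D ∈ Gd} ⊆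
              {i : ℕ | i ∈ Set.Icc 1 L ∧ par^[i] D ∈ Gd} := by
            rintro i ⟨⟨hi1, hiL⟩, hiG⟩
            refine ⟨⟨hi1, ?_⟩, hiG⟩
            by_contra h
            have hi : i = L + 1 := by omega
            rw [hi, hSR D hD] at hiG
            exact hR hiG
          have := Set.ncard_le_ncard hsub ((Set.finite_Icc 1 L).subset fun i hi => hi.1)
          exact (hSG D hD).trans this
        calc (S.card : ℝ) = ∑ P ∈ C, ((S.filter fun D => par^[L] D = P).card : ℝ) := by
              rw [Finset.card_eq_sum_card_fiberwise (f := fun D => par^[L] D) (t := C)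
                fun D hD => Finset.mem_image_of_mem _ hD]
              push_cast
              rfl
          _ ≤ ∑ P ∈ C, (4 : ℝ) ^ L * (1 - ε) ^ (G / m) := Finset.sum_le_sum hfib
          _ = C.card * ((4 : ℝ) ^ L * (1 - ε) ^ (G / m)) := by rw [Finset.sum_const, nsmul_eq_mul]
          _ ≤ 4 * ((4 : ℝ) ^ L * (1 - ε) ^ (G / m)) := by gcongr
          _ = 4 ^ (L + 1) * (1 - ε) ^ (G / m) := by ring

end TreeCount

end Literature.Probability.RandomPlanarGeometry
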